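import Literature.NumberTheory.EllipticCurves.KellerYin2024.GenusHeckeCharacterConductorProofs
import Literature.NumberTheory.EllipticCurves.RankinSelbergBaseChangeLocalFactorProofs
import Literature.NumberTheory.EllipticCurves.RankinSelbergEulerProductHeckeProofs
import Literature.NumberTheory.EllipticCurves.QuadraticTwistLFunctionProofs
import Literature.NumberTheory.EllipticCurves.LFunctionSmulProofs
import HarnessLib

/-!
# `L(f̃ / K, χ_ε·φ, s) = L(f / K, φ, s)` for `f = f̃ ⊗ ε`: twisting the form by the quadratic character `ε` of
# conductor `p` versus twisting the Hecke character by the genus character `χ_ε = ε ∘ N_{K/ℚ}`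

Topic `Literature/NumberTheory/EllipticCurves`, namespace `Literature.NumberTheory.EllipticCurves`.  Cell
`bsd-schneider-ideate`, seat `bsd-schneider-door-c5` (prover, generation 19); serves crux r3 `GordTwoBranchIMC`
(stmt-BirchSwinnertonDyer-19177) of route `SchneiderFreeAdditiveX3` — input (M1) of the «interpolation matching» between
Keller–Yin's branch `𝓛_ε = 𝓛_𝔭(f̃)(χ_ε ·)` (Castella–Hsieh's measure of the good-ordinary member `f̃` of the Heegner pair
on the `χ_ε`-branch, interpolating `L(f̃/K, χ_ε φ, 1)`) and the frames of the newform `f = f_E = f̃ ⊗ ε` itself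
(interpolating `L(f/K, φ, 1)`; Castella 2018 / Liu–Zhang–Zhang 2018 / Hsieh 2014 shapes) — FINDING-door-c5-g19 §2.

MATHEMATICS (Gross 2004 §3 bookkeeping; Keller–Yin arXiv:2410.23241 Prop. 3.1.3 "`f = f̃ ⊗ ε`", `χ_ε := ε ∘ N_{K/ℚ}`).  In the
tree `L(f/K, φ, s)` is the Euler product `rankinSelbergEulerProductHecke f φ s = ∏_v F_v(s)⁻¹` over the finite places `v` of
`K`, `F_v(s) = 1 − (α_ℓ^k + β_ℓ^k)·w·N(v)^{−s} + e^k w² N(v)^{−2s}` (`N(v) = ℓ^k`, `α + β = a_ℓ(f)`, `αβ = e = ℓ·𝟙_{ℓ ∤ N}`,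
`w = φ(ϖ_v)` extended by zero).  If `a_ℓ(f) = (ℓ/p)·a_ℓ(f̃)` for every prime `ℓ ≠ p`, `a_p(f) = 0`, `p ∣ N` and the
levels of `f`, `f̃` have the same prime divisors off `p`, then for every Hecke character `φ` of `K` unramified at all finite
places the local factors of `(f̃, χ_ε φ)` and `(f, φ)` agree at EVERY `v`:
* `v ∤ p`, `N(v) = ℓ^k`: `χ_ε(ϖ_v) = ε(ℓ)^k` (`compRelNorm_ofDirichlet_valueAtUniformizer`, any `ℓ ≠ p`, ramified in `K` or
  not), `(χ_ε φ)(ϖ_v) = ε(ℓ)^k φ(ϖ_v)`, and with `s = (ℓ/p) = ±1`: `α^k + β^k` for `f` is `s^k (α̃^k + β̃^k)`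
  (`frobTracePow_mul_left_of_sq_eq_one`), `s^{2k} = 1`;
* `v ∣ p`: the `f`-factor is `1` (`a_p(f) = 0`, `e = 0`), and the `f̃`-factor is `1` because `χ_ε φ` is RAMIFIED at `v`
  (`χ_ε` has conductor exponent `1` at `v ∣ p` for `p` odd and unramified in `K` — `genusHeckeCharacter_not_isUnramifiedAt` —
  and `φ` is unramified), so `(χ_ε φ)(ϖ_v)` is `0` by the extension-by-zero convention.
Hence the Euler products coincide as functions of `s` (`rankinSelbergEulerProductHecke_genusTwist_eq`), and so do the special
values defined through their continuations (`rankinSelbergValueHecke_genusTwist_eq`; the definition `rankinSelbergValueHecke`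
only sees the Euler product, junk case included — NO continuation fact is used).

HONEST FRAMING: THEOREMS ONLY (no definition, no named fact, no `sorry`, no instance); pure Euler-factor bookkeeping on the
tree's definitions; nothing is asserted about BSD or about Keller–Yin's preprint; serves 19177 as a helper, closes nothing.
References: [Gross2004] §3 p. 40 (genus characters `θ ∘ N_{K/ℚ}`, `L(f, χ, s) = L(A₁,s)L(A₂,s)` bookkeeping);
[KellerYin2024b] arXiv:2410.23241 Prop. 3.1.3 and §3.4 p. 19 (the Heegner pair, `χ_ε`, `𝓛_ε`); [Nekovar1995] (0.5), §3.4 (the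
local factors).
-/

noncomputable section

open scoped Classical

open CongruenceSubgroup NumberField IsDedekindDomain Ideal
  Literature.NumberTheory.GaloisRepresentations
  Literature.NumberTheory.EllipticCurves.ModularForms
  Literature.NumberTheory.EllipticCurves.KellerYin2024

namespace Literature.NumberTheory.EllipticCurves

/-! ### §1 Two identities for the Frobenius power sums -/

/-- **Scaling the trace by a sign scales the power sums**: if `s² = 1` then `α^k + β^k` for the pair with trace `s·a`
and norm `e` is `s^k (α^k + β^k)` (the roots `sα, sβ` have product `s²e = e`).  By the Newton recursion.
[cite: Nekovar1995, (0.5) p. 611 (the local factor through α^k + β^k)] -/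
theorem frobTracePow_mul_left_of_sq_eq_one {s : ℂ} (hs : s ^ 2 = 1) (a e : ℂ) :
    ∀ k : ℕ, frobTracePow (s * a) e k = s ^ k * frobTracePow a e k
  | 0 => by simp
  | 1 => by simp
  | k + 2 => by
    rw [frobTracePow, frobTracePow_mul_left_of_sq_eq_one hs a e (k + 1),
      frobTracePow_mul_left_of_sq_eq_one hs a e k, frobTracePow]
    have hk2 : s ^ (k + 2) = s ^ k := by rw [pow_add, hs, mul_one]
    rw [hk2, pow_succ]
    linear_combination (a * s ^ k * frobTracePow a e (k + 1)) * hs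

/-- **`α^k + β^k = 0` for `k ≥ 1` when `a = e = 0`** (both roots vanish: the Euler factor of a form with `a_p = 0` at a
prime dividing the level is `1`). [cite: Nekovar1995, §3.4 (α_ℓ β_ℓ = 0 for ℓ ∣ N)] -/
theorem frobTracePow_zero_zero_of_ne_zero : ∀ {k : ℕ}, k ≠ 0 → frobTracePow 0 0 k = 0
  | 0, h => (h rfl).elim
  | 1, _ => by simp
  | k + 2, _ => by simp [frobTracePow]

/-! ### §2 A prime of `𝓞 K` contains the minimal prime factor of its norm -/

variable {K : Type} [Field K] [NumberField K]

/-- The residue characteristic `ℓ = N(v).minFac` lies in `𝔭_v` (since `N(v) = ℓ^k ∈ 𝔭_v`).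
[cite: NeukirchANT1999, Ch. I §8 (8.2)–(8.3)] -/
theorem natCast_minFac_absNorm_mem (v : HeightOneSpectrum (𝓞 K)) :
    (((absNorm v.asIdeal).minFac : ℕ) : 𝓞 K) ∈ v.asIdeal := by
  obtain ⟨k, _, -, _, hN, -⟩ := absNorm_heightOneSpectrum_eq_pow v
  have h1 : ((absNorm v.asIdeal : ℕ) : 𝓞 K) ∈ v.asIdeal := Ideal.absNorm_mem v.asIdeal
  rw [hN, Nat.cast_pow] at h1
  exact Ideal.IsPrime.mem_of_pow_mem v.isPrime _ h1

/-! ### §3 Ramification of `χ_ε φ` above `p` and its value away from `p` -/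

/-- If `χφ` and `φ` are unramified at `v` then so is `χ` (`χ = (χφ)·φ⁻¹` on the local units). [folklore] -/
private theorem HeckeCharacter.isUnramifiedAt_of_mul {χ φ : HeckeCharacter K} {v : HeightOneSpectrum (𝓞 K)}
    (hχφ : (χ * φ).IsUnramifiedAt v) (hφ : φ.IsUnramifiedAt v) : χ.IsUnramifiedAt v := by
  intro u
  have h1 := hχφ u
  have h2 := hφ u
  rw [HeckeCharacter.localComponent_apply] at h1 h2 ⊢
  rwa [HeckeCharacter.mul_apply, h2, mul_one] at h1

section Genus

variable (K) [IsGalois ℚ K] (p : ℕ) [Fact p.Prime]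

/-- **`χ_ε φ` is ramified at every `v ∣ p`** (`p` odd, unramified in `K`; `φ` unramified at `v`), hence its Hecke value at `v`
extended by zero VANISHES. [cite: NeukirchANT1999, Ch. VII Prop. (6.9) (ψ_χ ramified exactly at the conductor)] -/
theorem heckeValueExtZero_genusHeckeCharacter_mul_eq_zero (hp2 : p ≠ 2)
    (hK : Algebra.IsUnramifiedIn (𝓞 K) (Ideal.span {(p : ℤ)})) {φ : HeckeCharacter K}
    {v : HeightOneSpectrum (𝓞 K)} (hφ : φ.IsUnramifiedAt v) (hpv : ((p : ℕ) : 𝓞 K) ∈ v.asIdeal) :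
    heckeValueExtZero (genusHeckeCharacter K p * φ) v = 0 :=
  heckeValueExtZero_of_not_isUnramifiedAt fun h =>
    genusHeckeCharacter_not_isUnramifiedAt K p hp2 hK hpv (HeckeCharacter.isUnramifiedAt_of_mul h hφ)

/-- **`(χ_ε φ)(ϖ_v) = (ℓ/p)^k · φ(ϖ_v)` at a place `v` over a prime `ℓ ≠ p` with `N(v) = ℓ^k`** (`φ` unramified at `v`;
`χ_ε = ε ∘ N_{K/ℚ}` is unramified at `v` with value `ε(ℓ)^{f_v}`, whether or not `ℓ` ramifies in `K`).
[cite: Gross2004, §3 (p. 40)] [cite: CasselsFrohlichANT1967, Ch. VII §6.3 (ω ∘ N at a uniformiser)] -/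
theorem heckeValueExtZero_genusHeckeCharacter_mul_of_ne {ℓ : ℕ} (hℓ : ℓ.Prime) (hℓp : ℓ ≠ p)
    {φ : HeckeCharacter K} {v : HeightOneSpectrum (𝓞 K)} (hφ : φ.IsUnramifiedAt v)
    (hℓv : ((ℓ : ℕ) : 𝓞 K) ∈ v.asIdeal) :
    heckeValueExtZero (genusHeckeCharacter K p * φ) v =
      ((legendreSym p ℓ : ℤ) : ℂ) ^ (absNorm v.asIdeal).factorization ℓ * heckeValueExtZero φ v := by
  have hℓp' : ¬ ℓ ∣ p := fun h =>
    hℓp (((Nat.prime_dvd_prime_iff_eq hℓ (Fact.out : p.Prime)).mp h))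
  have hw : v.asIdeal ∈ primesOver (Ideal.span {(ℓ : ℤ)}) (𝓞 K) :=
    ⟨v.isPrime, liesOver_span_of_natCast_mem_asIdeal hℓ v hℓv⟩
  obtain ⟨hunr, hval⟩ := compRelNorm_ofDirichlet_valueAtUniformizer K
    ((quadraticChar (ZMod p)).ringHomComp (Int.castRingHom ℂ)) hℓ hℓp' hw
  rw [genusHeckeCharacter_def, heckeValueExtZero_of_isUnramifiedAt (hunr.mul hφ),
    heckeValueExtZero_of_isUnramifiedAt hφ, HeckeCharacter.valueAtUniformizer_mul, hval,
    quadraticChar_ringHomComp_apply_natCast]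

end Genus

/-! ### §4 The local factors, the Euler products and the special values agree -/

section Twist

variable (K) [IsGalois ℚ K] {p : ℕ} [Fact p.Prime] {N N' : ℕ}

/-- **The local Rankin–Selberg factors of `(f̃, χ_ε φ)` and `(f, φ)` agree at every finite place** under the coefficient
relation `a_ℓ(f) = (ℓ/p) a_ℓ(f̃)` (`ℓ ≠ p`), `a_p(f) = 0`, `p ∣ N`, equal prime support of the levels off `p`, for `p` odd
and unramified in `K` and `φ` unramified everywhere. [cite: Gross2004, §3 (p. 40)] [cite: Nekovar1995, (0.5) p. 611 and §3.4] -/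
theorem rankinSelbergLocalFactorInvHecke_genusTwist_eq (hp2 : p ≠ 2)
    (hK : Algebra.IsUnramifiedIn (𝓞 K) (Ideal.span {(p : ℤ)}))
    (f : CuspForm (Gamma0 N) 2) (f' : CuspForm (Gamma0 N') 2)
    (hcoef : ∀ ℓ : ℕ, ℓ.Prime → ℓ ≠ p → cuspCoeff f ℓ = ((legendreSym p ℓ : ℤ) : ℂ) * cuspCoeff f' ℓ)
    (hap : cuspCoeff f p = 0) (hpN : p ∣ N) (hlev : ∀ ℓ : ℕ, ℓ.Prime → ℓ ≠ p → (ℓ ∣ N ↔ ℓ ∣ N'))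
    {φ : HeckeCharacter K} (hφ : ∀ v : HeightOneSpectrum (𝓞 K), φ.IsUnramifiedAt v)
    (v : HeightOneSpectrum (𝓞 K)) (s : ℂ) :
    rankinSelbergLocalFactorInvHecke f' (genusHeckeCharacter K p * φ) v s =
      rankinSelbergLocalFactorInvHecke f φ v s := by
  obtain ⟨k, hk0, -, hℓ, hNv, hfac⟩ := absNorm_heightOneSpectrum_eq_pow v
  set ℓ : ℕ := (absNorm v.asIdeal).minFac with hℓdef
  have hℓv : ((ℓ : ℕ) : 𝓞 K) ∈ v.asIdeal := natCast_minFac_absNorm_mem v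
  rw [rankinSelbergLocalFactorInvHecke_of_absNorm_eq_pow f' _ hℓ hk0.ne' hNv,
    rankinSelbergLocalFactorInvHecke_of_absNorm_eq_pow f _ hℓ hk0.ne' hNv]
  by_cases hℓp : ℓ = p
  · -- above `p`: both factors are `1`
    have hpv : ((p : ℕ) : 𝓞 K) ∈ v.asIdeal := hℓp ▸ hℓv
    rw [heckeValueExtZero_genusHeckeCharacter_mul_eq_zero K p hp2 hK (hφ v) hpv, hℓp, hap, if_pos hpN,
      frobTracePow_zero_zero_of_ne_zero hk0.ne', zero_pow hk0.ne']
    ring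
  · -- away from `p`
    have hs : (((legendreSym p ℓ : ℤ) : ℂ)) ^ 2 = 1 := by
      have hℓ0 : ((ℓ : ℤ) : ZMod p) ≠ 0 := by
        rw [Int.cast_natCast, Ne, ZMod.natCast_eq_zero_iff]
        exact fun h => hℓp ((Nat.prime_dvd_prime_iff_eq (Fact.out : p.Prime) hℓ).mp h).symm
      exact_mod_cast legendreSym.sq_one (p := p) hℓ0
    have hsk : ((((legendreSym p ℓ : ℤ) : ℂ)) ^ k) ^ 2 = 1 := by
      rw [← pow_mul, mul_comm, pow_mul, hs, one_pow]
    have he : (if ℓ ∣ N' then (0 : ℂ) else (ℓ : ℂ)) = (if ℓ ∣ N then (0 : ℂ) else (ℓ : ℂ)) := by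
      by_cases h : ℓ ∣ N
      · rw [if_pos h, if_pos ((hlev ℓ hℓ hℓp).mp h)]
      · rw [if_neg h, if_neg (mt (hlev ℓ hℓ hℓp).mpr h)]
    rw [heckeValueExtZero_genusHeckeCharacter_mul_of_ne K p hℓ hℓp (hφ v) hℓv, hfac, hcoef ℓ hℓ hℓp, he,
      frobTracePow_mul_left_of_sq_eq_one hs]
    linear_combination ((if ℓ ∣ N then (0 : ℂ) else (ℓ : ℂ)) ^ k * heckeValueExtZero φ v ^ 2 *
      ((((ℓ : ℂ)) ^ (-s)) ^ k) ^ 2) * hsk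

/-- **`L(f̃/K, χ_ε φ, s) = L(f/K, φ, s)` as Euler products** (every `s`): twisting the form by `ε = (·/p)` and twisting
the character by `χ_ε = ε ∘ N_{K/ℚ}` give the same Rankin–Selberg Euler product.  Hypotheses as in
`rankinSelbergLocalFactorInvHecke_genusTwist_eq`. [cite: Gross2004, §3 (p. 40) and §13 (p. 49)]
[cite: KellerYin2024b, Prop. 3.1.3 (arXiv:2410.23241 p. 14) (f = f̃ ⊗ ε, χ_ε = ε ∘ N; shape only, preprint)] -/
theorem rankinSelbergEulerProductHecke_genusTwist_eq (hp2 : p ≠ 2)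
    (hK : Algebra.IsUnramifiedIn (𝓞 K) (Ideal.span {(p : ℤ)}))
    (f : CuspForm (Gamma0 N) 2) (f' : CuspForm (Gamma0 N') 2)
    (hcoef : ∀ ℓ : ℕ, ℓ.Prime → ℓ ≠ p → cuspCoeff f ℓ = ((legendreSym p ℓ : ℤ) : ℂ) * cuspCoeff f' ℓ)
    (hap : cuspCoeff f p = 0) (hpN : p ∣ N) (hlev : ∀ ℓ : ℕ, ℓ.Prime → ℓ ≠ p → (ℓ ∣ N ↔ ℓ ∣ N'))
    {φ : HeckeCharacter K} (hφ : ∀ v : HeightOneSpectrum (𝓞 K), φ.IsUnramifiedAt v) (s : ℂ) :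
    rankinSelbergEulerProductHecke f' (genusHeckeCharacter K p * φ) s = rankinSelbergEulerProductHecke f φ s := by
  unfold rankinSelbergEulerProductHecke
  exact tprod_congr fun v =>
    by rw [rankinSelbergLocalFactorInvHecke_genusTwist_eq K hp2 hK f f' hcoef hap hpN hlev hφ v s]

/-- **`L(f̃/K, χ_ε φ, s₀) = L(f/K, φ, s₀)` for the special values through the continuation** (every `s₀`): the tree's
`rankinSelbergValueHecke` only sees the Euler product, so equal Euler products give equal values (junk case included; no
continuation theorem is used).  This is input (M1) of the interpolation matching between Keller–Yin's branch
`𝓛_ε = 𝓛_𝔭(f̃)(χ_ε ·)` and the BDP frames of `f = f̃ ⊗ ε`. [cite: Gross2004, §3 (p. 40)]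
[cite: KellerYin2024b, §3.4 (arXiv:2410.23241 p. 19) (𝓛_ε interpolates L(f̃/K, χ_ε φ, 1); shape only, preprint)] -/
theorem rankinSelbergValueHecke_genusTwist_eq (hp2 : p ≠ 2)
    (hK : Algebra.IsUnramifiedIn (𝓞 K) (Ideal.span {(p : ℤ)}))
    (f : CuspForm (Gamma0 N) 2) (f' : CuspForm (Gamma0 N') 2)
    (hcoef : ∀ ℓ : ℕ, ℓ.Prime → ℓ ≠ p → cuspCoeff f ℓ = ((legendreSym p ℓ : ℤ) : ℂ) * cuspCoeff f' ℓ)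
    (hap : cuspCoeff f p = 0) (hpN : p ∣ N) (hlev : ∀ ℓ : ℕ, ℓ.Prime → ℓ ≠ p → (ℓ ∣ N ↔ ℓ ∣ N'))
    {φ : HeckeCharacter K} (hφ : ∀ v : HeightOneSpectrum (𝓞 K), φ.IsUnramifiedAt v) (s₀ : ℂ) :
    rankinSelbergValueHecke f' (genusHeckeCharacter K p * φ) s₀ = rankinSelbergValueHecke f φ s₀ := by
  have hE : rankinSelbergEulerProductHecke f' (genusHeckeCharacter K p * φ) =
      rankinSelbergEulerProductHecke f φ :=
    funext fun s => rankinSelbergEulerProductHecke_genusTwist_eq K hp2 hK f f' hcoef hap hpN hlev hφ s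
  have hI : IsRankinSelbergValueHecke f' (genusHeckeCharacter K p * φ) s₀ =
      IsRankinSelbergValueHecke f φ s₀ := by
    funext L₀
    simp only [IsRankinSelbergValueHecke, hE]
  simp only [rankinSelbergValueHecke, hI]

end Twist

/-! ### §5 The elliptic-curve form: the newforms of `W′` and of its presented `p*`-twist `W = C₂ • ((D • W′) ⊗ χ_{p*})` -/

section Curves

variable (K) [IsGalois ℚ K] {p : ℕ} [Fact p.Prime]

/-- **The coefficient relation `a_ℓ(f) = (ℓ/p)·a_ℓ(f′)` at EVERY prime `ℓ ≠ p`** for the newforms `f` of the presented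
twist `W = C₂ • ((D • W′) ⊗ χ_{p*})` and `f′` of `W′` (`a_n` of a newform = `a_n` of its curve, `a_n` is invariant under
`ℚ`-isomorphisms, and `a_n(V ⊗ χ_{p*}) = (n/p)·a_n(V)` for `p ∤ n` at ALL such `n`, bad primes included) — the cofinite twist
relation of the Keller–Yin branch statement with the exceptional set `{p}` made explicit.
[cite: SilvermanAEC2009, X.2 Exercise 10.16] [cite: KellerYin2024b, Prop. 3.1.3 (arXiv:2410.23241 p. 14) (shape only, preprint)] -/
theorem cuspCoeff_eq_legendreSym_mul_of_presentation (hp2 : p ≠ 2) (W' : WeierstrassCurve ℚ) [W'.IsElliptic]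
    (D C₂ : WeierstrassCurve.VariableChange ℚ) [(C₂ • (D • W').quadraticTwist ((-1 : ℚ) ^ (p / 2) * p)).IsElliptic]
    {N N' : ℕ} [NeZero N] [NeZero N'] {f : CuspForm (Gamma0 N) 2} {f' : CuspForm (Gamma0 N') 2}
    (hf : IsNewformOf (C₂ • (D • W').quadraticTwist ((-1 : ℚ) ^ (p / 2) * p)) f) (hf' : IsNewformOf W' f')
    {ℓ : ℕ} (hℓ : ℓ.Prime) (hℓp : ℓ ≠ p) :
    cuspCoeff f ℓ = ((legendreSym p ℓ : ℤ) : ℂ) * cuspCoeff f' ℓ := by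
  have hpℓ : ¬ p ∣ ℓ := fun h =>
    hℓp ((Nat.prime_dvd_prime_iff_eq (Fact.out : p.Prime) hℓ).mp h).symm
  have hd0 : ((-1 : ℚ) ^ (p / 2) * p) ≠ 0 :=
    mul_ne_zero (pow_ne_zero _ (by norm_num)) (by exact_mod_cast (Fact.out : p.Prime).ne_zero)
  haveI : ((D • W').quadraticTwist ((-1 : ℚ) ^ (p / 2) * p)).IsElliptic :=
    (D • W').isElliptic_quadraticTwist hd0
  have hcast : (((-1 : ℤ) ^ (p / 2) * p : ℤ) : ℚ) = (-1 : ℚ) ^ (p / 2) * p := by push_cast; ring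
  have htw := (D • W').LFunction_quadraticTwist_pStar_apply hp2 hpℓ
  rw [hcast] at htw
  rw [hf.2 ℓ, hf'.2 ℓ, WeierstrassCurve.LFunction_smul, htw, WeierstrassCurve.LFunction_smul]
  push_cast
  ring

/-- **`L(f′/K, χ_ε φ, s₀) = L(f/K, φ, s₀)` for the newforms of `W′` and of its presented `p*`-twist `W`** (`p` odd and
unramified in `K`, `φ` unramified everywhere; `a_p(f) = 0`, `p ∣ N` and equal prime support of the levels off `p` — on the K1
door's cell: `W` additive at `p`, `N = N_W`, `N′ = N_{W′}`).  The special-value form of the twist identity, in the shape the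
Keller–Yin branch frames (`IsBranchBDPLFunction … f′ χ_ε …`) and the frames of `f` (`IsBDPLFunction … f …`) are compared in.
[cite: Gross2004, §3 (p. 40)] [cite: KellerYin2024b, §3.4 (arXiv:2410.23241 p. 19) (shape only, preprint)] -/
theorem rankinSelbergValueHecke_presentation_twist_eq (hp2 : p ≠ 2)
    (hK : Algebra.IsUnramifiedIn (𝓞 K) (Ideal.span {(p : ℤ)}))
    (W' : WeierstrassCurve ℚ) [W'.IsElliptic] (D C₂ : WeierstrassCurve.VariableChange ℚ)
    [(C₂ • (D • W').quadraticTwist ((-1 : ℚ) ^ (p / 2) * p)).IsElliptic]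
    {N N' : ℕ} [NeZero N] [NeZero N'] {f : CuspForm (Gamma0 N) 2} {f' : CuspForm (Gamma0 N') 2}
    (hf : IsNewformOf (C₂ • (D • W').quadraticTwist ((-1 : ℚ) ^ (p / 2) * p)) f) (hf' : IsNewformOf W' f')
    (hap : cuspCoeff f p = 0) (hpN : p ∣ N) (hlev : ∀ ℓ : ℕ, ℓ.Prime → ℓ ≠ p → (ℓ ∣ N ↔ ℓ ∣ N'))
    {φ : HeckeCharacter K} (hφ : ∀ v : HeightOneSpectrum (𝓞 K), φ.IsUnramifiedAt v) (s₀ : ℂ) :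
    rankinSelbergValueHecke f' (genusHeckeCharacter K p * φ) s₀ = rankinSelbergValueHecke f φ s₀ :=
  rankinSelbergValueHecke_genusTwist_eq K hp2 hK f f'
    (fun _ hℓ hℓp => cuspCoeff_eq_legendreSym_mul_of_presentation hp2 W' D C₂ hf hf' hℓ hℓp) hap hpN hlev hφ s₀

end Curves

end Literature.NumberTheory.EllipticCurves

end
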